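import Summits.NavierStokesRegularity.NavierStokesRegularity.Theorems.TypeIQuarterGateLorentzBenchmarkSharp
import Summits.NavierStokesRegularity.NavierStokesRegularity.Theorems.TypeIQuarterGateLorentzBoundEventual
import Literature.Analysis.FluidPDE.FlatSwirlGauge
import Literature.Analysis.FluidPDE.KatoSymmetryCovariance
import Literature.Analysis.FluidPDE.VorticityCalculus
import Mathlib.MeasureTheory.Group.LIntegral
import HarnessLib

/-!
# `TypeIQuarterGate`: the drifting satellite — the scar envelope is NOT a kinematic consequence of the
# quarter law, the Lorentz bound, the rate and finite scars

Tightness datum for `ScarEnvelopeTypeI` (stmt-NavierStokesRegularity-23843, «no satellites») relative to the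
Lorentz class `LorentzUpgradeTypeI ⟺ QuarterLawTypeI ⟺ UniformConcentrationCountTypeI` (p818591) and
`FiniteScarsTypeI` (23842).  `satellite_family`: the tree's divergence-free profile `θ = curl(η e₂)` at
amplitude `1/s`, width `s = √(1−t)`, centred at the drifting point `(1−t)^{1/4} e₀`, is a family of smooth
compactly supported divergence-free slices on `[0,1)` with the Type-I rate, bounded energy, Leray's quarter
rate `∫‖curl v(t)‖² ≤ z₀/√(1−t)`, a uniform weak-`L³` bound and finite scars `σ = {0}` (off the origin the
satellite has passed: `v = 0` on a backward parabolic neighbourhood), which VIOLATES the scar envelope for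
every finite `σ` and every `C'` (the satellite sits at distance `(1−t)^{1/4} ≫ √(1−t)` from the only scar
with the full Type-I amplitude).  READING: any proof of `FiniteScarsTypeI → envelope` must use the
Navier–Stokes dynamics to forbid satellites drifting into the scar slower than parabolically.
HONEST FRAMING: a statement about an explicit family of vector fields, not about solutions; nothing about
Navier–Stokes regularity or blow-up is claimed; 23843 remains OPEN. [folklore]
-/

-- the problem directory repeats the summit name (`NavierStokesRegularity/NavierStokesRegularity`)
set_option linter.dupNamespace false

noncomputable section

open Set Filter MeasureTheory Topology Metric Function
open scoped ENNReal NNReal ContDiff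

namespace Summit.NavierStokesRegularity.NavierStokesRegularity.Theorems

namespace LorentzOfEnvelope

open Literature.Analysis.FluidPDE Literature.Analysis.FunctionSpaces
open Literature.Analysis.FluidPDE.DistributionalToWeakCounterexample (θ θ_contDiff θ_hasCompactSupport
  θ_isDivFree exists_θ_ne_zero)

/-! ### The translated, dilated profile `x ↦ A • θ(c • (x − b))` -/

/-- Smoothness of the bump. [folklore] -/
theorem bump_contDiff (A c : ℝ) (b : EuclideanSpace ℝ (Fin 3)) :
    ContDiff ℝ ∞ fun x : EuclideanSpace ℝ (Fin 3) => A • θ (c • (x - b)) :=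
  ((θ_contDiff.comp ((contDiff_id.sub contDiff_const).const_smul c))).const_smul A

/-- Compact support of the bump (`c ≠ 0`). [folklore] -/
theorem bump_hasCompactSupport (A : ℝ) {c : ℝ} (hc : c ≠ 0) (b : EuclideanSpace ℝ (Fin 3)) :
    HasCompactSupport fun x : EuclideanSpace ℝ (Fin 3) => A • θ (c • (x - b)) := by
  have h1 : HasCompactSupport fun y : EuclideanSpace ℝ (Fin 3) => θ (c • y) := θ_hasCompactSupport.comp_smul hc
  have h2 : HasCompactSupport fun x : EuclideanSpace ℝ (Fin 3) => θ (c • (x - b)) := by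
    have := h1.comp_homeomorph (Homeomorph.subRight b)
    exact this
  exact h2.mono fun x hx => right_ne_zero_of_smul hx

/-- The bump is divergence free. [folklore] -/
theorem bump_isDivFree (A c : ℝ) (b : EuclideanSpace ℝ (Fin 3)) :
    VectorCalculus.IsDivFree fun x : EuclideanSpace ℝ (Fin 3) => A • θ (c • (x - b)) := by
  have h1 : VectorCalculus.IsDivFree fun y : EuclideanSpace ℝ (Fin 3) => θ (c • y) := θ_isDivFree.comp_smul c
  have h2 : VectorCalculus.IsDivFree fun x : EuclideanSpace ℝ (Fin 3) => θ (c • (x + -b)) :=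
    h1.comp_add_right (-b)
  have h2' : VectorCalculus.IsDivFree fun x : EuclideanSpace ℝ (Fin 3) => θ (c • (x - b)) := by
    simpa [sub_eq_add_neg] using h2
  have hd : Differentiable ℝ fun x : EuclideanSpace ℝ (Fin 3) => θ (c • (x - b)) :=
    (θ_contDiff.comp ((contDiff_id.sub contDiff_const).const_smul c)).differentiable (by simp)
  exact h2'.const_smul hd A

/-- Energy of the bump: `∫‖A θ(c(x−b))‖² = A² c⁻³ ∫‖θ‖²` (`A ≥ 0`, `c > 0`). [folklore] -/
theorem bump_lintegral_sq {A c : ℝ} (hA : 0 ≤ A) (hc : 0 < c) (b : EuclideanSpace ℝ (Fin 3)) :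
    ∫⁻ x, ‖A • θ (c • (x - b))‖ₑ ^ 2 =
      ENNReal.ofReal (A ^ 2) * (ENNReal.ofReal ((c ^ 3)⁻¹) * ∫⁻ x, ‖θ x‖ₑ ^ 2) := by
  have h := lintegral_sub_right_eq_self (μ := (volume : Measure (EuclideanSpace ℝ (Fin 3))))
    (fun y => ‖A • θ (c • y)‖ₑ ^ 2) b
  rw [h]
  exact lintegral_sq_dilate θ hA hc

/-- Curl of the bump: `curl (A θ(c(· − b)))(x) = (A c) • (curl θ)(c(x − b))`. [folklore] -/
theorem curl_bump (A c : ℝ) (b x : EuclideanSpace ℝ (Fin 3)) :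
    curl (fun y : EuclideanSpace ℝ (Fin 3) => A • θ (c • (y - b))) x = (A * c) • curl θ (c • (x - b)) := by
  have h1 : (fun y : EuclideanSpace ℝ (Fin 3) => A • θ (c • (y - b))) =
      fun y => (fun z => A • θ (c • z)) (y + -b) := by
    funext y; simp [sub_eq_add_neg]
  rw [h1, curl_comp_add_const (fun z => A • θ (c • z)) (-b) x, curl_smul_comp_smul, ← sub_eq_add_neg]

/-- Enstrophy of the bump: `∫‖curl(A θ(c(x−b)))‖² = (A c)² c⁻³ ∫‖curl θ‖²` (`A ≥ 0`, `c > 0`). [folklore] -/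
theorem bump_lintegral_curl_sq {A c : ℝ} (hA : 0 ≤ A) (hc : 0 < c) (b : EuclideanSpace ℝ (Fin 3)) :
    ∫⁻ x, ‖curl (fun y : EuclideanSpace ℝ (Fin 3) => A • θ (c • (y - b))) x‖ₑ ^ 2 =
      ENNReal.ofReal ((A * c) ^ 2) * (ENNReal.ofReal ((c ^ 3)⁻¹) * ∫⁻ x, ‖curl θ x‖ₑ ^ 2) := by
  simp_rw [curl_bump]
  have h := lintegral_sub_right_eq_self (μ := (volume : Measure (EuclideanSpace ℝ (Fin 3))))
    (fun y => ‖(A * c) • curl θ (c • y)‖ₑ ^ 2) b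
  rw [h]
  exact lintegral_sq_dilate (curl θ) (mul_nonneg hA hc.le) hc

/-! ### Clean-context arithmetic for the envelope violation -/

/-- The envelope term at the scar: `C'/(‖X‖ + s) ≤ 2|C'|/ρ` when `‖X‖ ≥ ρ/2`. [folklore] -/
theorem envelope_term_scar {X : EuclideanSpace ℝ (Fin 3)} {ρ s Cabs C' : ℝ} (hρ : 0 < ρ) (hs : 0 < s)
    (hCabs : 0 ≤ Cabs) (hC' : C' ≤ Cabs) (hX : ρ / 2 ≤ ‖X‖) :
    C' / (‖X - 0‖ + s) ≤ 2 * Cabs / ρ := by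
  rw [sub_zero]
  have hden : 0 < ‖X‖ + s := by positivity
  calc C' / (‖X‖ + s) ≤ Cabs / (‖X‖ + s) := div_le_div_of_nonneg_right hC' hden.le
    _ ≤ Cabs / (ρ / 2) := div_le_div_of_nonneg_left hCabs (by positivity) (by linarith)
    _ = 2 * Cabs / ρ := by field_simp

/-- The envelope term at another scar `b ≠ 0` with `4/‖b‖ ≤ D`, `ρ(1+D) ≤ 1`, `‖X‖ ≤ 2ρ`:
`C'/(‖X − b‖ + s) ≤ |C'|(1+D)/2`. [folklore] -/
theorem envelope_term_far {X b : EuclideanSpace ℝ (Fin 3)} {ρ s Cabs C' D : ℝ} (hρ : 0 < ρ)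
    (hs : 0 < s) (hCabs : 0 ≤ Cabs) (hC' : C' ≤ Cabs) (hD0 : 0 ≤ D) (hXle : ‖X‖ ≤ 2 * ρ)
    (hb0 : b ≠ 0) (hbD : 4 / ‖b‖ ≤ D) (hρD : ρ * (1 + D) ≤ 1) :
    C' / (‖X - b‖ + s) ≤ Cabs * (1 + D) / 2 := by
  have hbpos : 0 < ‖b‖ := norm_pos_iff.2 hb0
  have hbD' : 4 ≤ D * ‖b‖ := by rwa [div_le_iff₀ hbpos] at hbD
  have hb4 : 4 * ρ ≤ ‖b‖ := by nlinarith
  have hxb : ‖b‖ / 2 ≤ ‖X - b‖ := by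
    have := norm_sub_norm_le b X
    rw [norm_sub_rev] at this
    linarith
  have hden : 0 < ‖X - b‖ + s := by positivity
  calc C' / (‖X - b‖ + s) ≤ Cabs / (‖X - b‖ + s) := div_le_div_of_nonneg_right hC' hden.le
    _ ≤ Cabs / (‖b‖ / 2) := div_le_div_of_nonneg_left hCabs (by positivity) (by linarith)
    _ ≤ Cabs * (1 + D) / 2 := by
        rw [div_le_iff₀ (by positivity)]
        have h3 : 2 ≤ (1 + D) * (‖b‖ / 2) := by nlinarith
        nlinarith

/-- The endgame: `w₀/ρ² ≤ |C'| + n(|C'|(1+D)/2 + 2|C'|/ρ)` contradicts `ρ · 2L ≤ w₀`, `ρ ≤ 1`,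
`L = |C'|(3 + n(1+D)/2) + 1`. [folklore] -/
theorem envelope_endgame {w₀ ρ Cabs D n L : ℝ} (hL : L = Cabs * (1 + n * (1 + D) / 2 + 2 * n) + 1)
    (hρ : 0 < ρ) (hρ1 : ρ ≤ 1) (hCabs : 0 ≤ Cabs) (hD0 : 0 ≤ D) (hn : 0 ≤ n)
    (hρL : ρ * (2 * L) ≤ w₀)
    (hfinal : w₀ / ρ ^ 2 ≤ Cabs + n * (Cabs * (1 + D) / 2 + 2 * Cabs / ρ)) : False := by
  have h := (div_le_iff₀ (pow_pos hρ 2)).1 hfinal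
  have e1 : (Cabs + n * (Cabs * (1 + D) / 2 + 2 * Cabs / ρ)) * ρ ^ 2 =
      ρ ^ 2 * (Cabs + n * (Cabs * (1 + D) / 2)) + ρ * (2 * n * Cabs) := by
    field_simp
    ring
  rw [e1] at h
  have hρsq : ρ ^ 2 ≤ ρ := by nlinarith
  have hA0 : 0 ≤ Cabs + n * (Cabs * (1 + D) / 2) := by positivity
  have h1 : w₀ ≤ ρ * (Cabs + n * (Cabs * (1 + D) / 2) + 2 * n * Cabs) := by
    have := mul_le_mul_of_nonneg_right hρsq hA0
    nlinarith
  have hLm : Cabs + n * (Cabs * (1 + D) / 2) + 2 * n * Cabs = L - 1 := by rw [hL]; ring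
  rw [hLm] at h1
  have hL1 : 1 ≤ L := by
    rw [hL]
    have : 0 ≤ Cabs * (1 + n * (1 + D) / 2 + 2 * n) := by positivity
    linarith
  nlinarith

/-! ### The drifting satellite family -/

/-- **The drifting satellite.** See the module docstring: a family on `[0,1)` of smooth compactly supported
divergence-free fields with the Type-I rate, bounded energy, Leray's quarter rate, a uniform weak-`L³` bound
and finite scars `σ = {0}`, which violates the scar envelope for every finite `σ` and every `C'`. [folklore] -/
theorem satellite_family :
    ∃ v : ℝ → EuclideanSpace ℝ (Fin 3) → EuclideanSpace ℝ (Fin 3),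
      (∀ t ∈ Ico (0 : ℝ) 1, ContDiff ℝ ∞ (v t)) ∧
      (∀ t ∈ Ico (0 : ℝ) 1, HasCompactSupport (v t)) ∧
      (∀ t ∈ Ico (0 : ℝ) 1, VectorCalculus.IsDivFree (v t)) ∧
      (∃ C : ℝ, ∀ t ∈ Ico (0 : ℝ) 1, ∀ x, ‖v t x‖ ≤ C / Real.sqrt (1 - t)) ∧
      (∃ E : ℝ, ∀ t ∈ Ico (0 : ℝ) 1, ∫⁻ x, ‖v t x‖ₑ ^ 2 ≤ ENNReal.ofReal E) ∧
      (∃ K : ℝ, ∀ t ∈ Ico (0 : ℝ) 1,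
        ∫⁻ x, ‖curl (v t) x‖ₑ ^ 2 ≤ ENNReal.ofReal (K / Real.sqrt (1 - t))) ∧
      (∃ M' : ℝ, ∀ t ∈ Ico (0 : ℝ) 1, eWeakLpPow (v t) 3 volume ≤ ENNReal.ofReal M') ∧
      (∃ σ : Finset (EuclideanSpace ℝ (Fin 3)), ∀ x ∉ σ, ∃ r : ℝ, 0 < r ∧ ∃ A : ℝ,
        ∀ t ∈ Ico (1 - r ^ 2) (1 : ℝ), ∀ y ∈ ball x r, ‖v t y‖ ≤ A) ∧
      ¬ (∃ (σ : Finset (EuclideanSpace ℝ (Fin 3))) (C' : ℝ), ∀ t ∈ Ico (0 : ℝ) 1, ∀ x,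
        ‖v t x‖ ≤ C' + ∑ a ∈ σ, C' / (‖x - a‖ + Real.sqrt (1 - t))) := by
  obtain ⟨z₀, hz₀⟩ := exists_θ_ne_zero
  set w₀ : ℝ := ‖θ z₀‖ with hw₀_def
  have hw₀ : 0 < w₀ := norm_pos_iff.2 hz₀
  obtain ⟨S, hS⟩ := θ_contDiff.continuous.bounded_above_of_compact_support θ_hasCompactSupport
  have hS0 : 0 ≤ S := (norm_nonneg _).trans (hS 0)
  obtain ⟨Rθ, hRθ⟩ : ∃ R : ℝ, tsupport θ ⊆ closedBall (0 : EuclideanSpace ℝ (Fin 3)) R :=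
    (θ_hasCompactSupport.isCompact.isBounded).subset_closedBall 0
  have hθzero : ∀ z : EuclideanSpace ℝ (Fin 3), Rθ < ‖z‖ → θ z = 0 := by
    intro z hz
    apply image_eq_zero_of_notMem_tsupport
    intro hmem
    have := hRθ hmem
    rw [mem_closedBall, dist_zero_right] at this
    linarith
  have hRθ0 : 0 ≤ Rθ := by
    by_contra hneg
    push Not at hneg
    exact hz₀ (hθzero z₀ (hneg.trans_le (norm_nonneg _)))
  have hθmem : MemLp θ 2 (volume : Measure (EuclideanSpace ℝ (Fin 3))) :=
    θ_contDiff.continuous.memLp_of_hasCompactSupport θ_hasCompactSupport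
  set e₀ : ℝ := 2 * VectorCalculus.kineticEnergy θ with he₀_def
  have he₀eq : ∫⁻ x, ‖θ x‖ₑ ^ 2 = ENNReal.ofReal e₀ := eEnergy_eq_ofReal θ hθmem
  have he₀nn : 0 ≤ e₀ := by rw [he₀_def]; exact mul_nonneg zero_le_two (kineticEnergy_nonneg θ)
  have hcθ_cont : Continuous (curl θ) := continuous_curl (θ_contDiff.of_le (by norm_cast))
  have hcθ_mem : MemLp (curl θ) 2 (volume : Measure (EuclideanSpace ℝ (Fin 3))) :=
    hcθ_cont.memLp_of_hasCompactSupport (hasCompactSupport_curl θ_hasCompactSupport)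
  set z₀e : ℝ := 2 * VectorCalculus.kineticEnergy (curl θ) with hz₀e_def
  have hz₀eq : ∫⁻ x, ‖curl θ x‖ₑ ^ 2 = ENNReal.ofReal z₀e := eEnergy_eq_ofReal (curl θ) hcθ_mem
  have hz₀nn : 0 ≤ z₀e := by rw [hz₀e_def]; exact mul_nonneg zero_le_two (kineticEnergy_nonneg _)
  set e : EuclideanSpace ℝ (Fin 3) := EuclideanSpace.single 0 1 with he_def
  have he : ‖e‖ = 1 := by rw [he_def, PiLp.norm_single, norm_one]
  set sf : ℝ → ℝ := fun t => Real.sqrt (1 - t) with hsf_def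
  set ρf : ℝ → ℝ := fun t => Real.sqrt (Real.sqrt (1 - t)) with hρf_def
  set v : ℝ → EuclideanSpace ℝ (Fin 3) → EuclideanSpace ℝ (Fin 3) :=
    fun t x => (sf t)⁻¹ • θ ((sf t)⁻¹ • (x - ρf t • e)) with hv_def
  have hsf : ∀ t ∈ Ico (0 : ℝ) 1, 0 < sf t ∧ sf t ≤ 1 := fun t ht =>
    ⟨Real.sqrt_pos.2 (by linarith [ht.2]), Real.sqrt_le_one.mpr (by linarith [ht.1])⟩
  refine ⟨v, fun t _ => bump_contDiff _ _ _, fun t ht => bump_hasCompactSupport _ (inv_ne_zero (hsf t ht).1.ne') _,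
    fun t _ => bump_isDivFree _ _ _, ?_, ?_, ?_, ?_, ?_, ?_⟩
  · -- Type-I rate `‖v(t)‖ ≤ S/√(1−t)`
    refine ⟨S, fun t ht x => ?_⟩
    obtain ⟨hs, -⟩ := hsf t ht
    show ‖(sf t)⁻¹ • θ ((sf t)⁻¹ • (x - ρf t • e))‖ ≤ S / Real.sqrt (1 - t)
    rw [norm_smul, Real.norm_of_nonneg (inv_nonneg.2 hs.le), div_eq_inv_mul]
    exact mul_le_mul_of_nonneg_left (hS _) (inv_nonneg.2 hs.le)
  · -- energy `∫‖v(t)‖² = s e₀ ≤ e₀`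
    refine ⟨e₀, fun t ht => ?_⟩
    obtain ⟨hs, hs1⟩ := hsf t ht
    show ∫⁻ x, ‖(sf t)⁻¹ • θ ((sf t)⁻¹ • (x - ρf t • e))‖ₑ ^ 2 ≤ ENNReal.ofReal e₀
    rw [bump_lintegral_sq (inv_nonneg.2 hs.le) (inv_pos.2 hs) _, he₀eq, ← ENNReal.ofReal_mul (by positivity),
      ← ENNReal.ofReal_mul (by positivity)]
    refine ENNReal.ofReal_le_ofReal ?_
    have : (sf t)⁻¹ ^ 2 * (((sf t)⁻¹ ^ 3)⁻¹ * e₀) = sf t * e₀ := by field_simp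
    rw [this]
    exact mul_le_of_le_one_left he₀nn hs1
  · -- quarter law `∫‖curl v(t)‖² = z₀/s`
    refine ⟨z₀e, fun t ht => ?_⟩
    obtain ⟨hs, -⟩ := hsf t ht
    show ∫⁻ x, ‖curl (fun y => (sf t)⁻¹ • θ ((sf t)⁻¹ • (y - ρf t • e))) x‖ₑ ^ 2 ≤
      ENNReal.ofReal (z₀e / Real.sqrt (1 - t))
    rw [bump_lintegral_curl_sq (inv_nonneg.2 hs.le) (inv_pos.2 hs) _, hz₀eq,
      ← ENNReal.ofReal_mul (by positivity), ← ENNReal.ofReal_mul (by positivity)]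
    refine ENNReal.ofReal_le_ofReal (le_of_eq ?_)
    show ((sf t)⁻¹ * (sf t)⁻¹) ^ 2 * (((sf t)⁻¹ ^ 3)⁻¹ * z₀e) = z₀e / sf t
    field_simp
  · -- uniform weak-L³: bounded-slice benchmark `B·E = (S/s)·(s e₀) = S e₀`
    refine ⟨S * e₀, fun t ht => ?_⟩
    obtain ⟨hs, -⟩ := hsf t ht
    have hB : ∀ x, ‖v t x‖ ≤ S / sf t := by
      intro x
      show ‖(sf t)⁻¹ • θ ((sf t)⁻¹ • (x - ρf t • e))‖ ≤ S / sf t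
      rw [norm_smul, Real.norm_of_nonneg (inv_nonneg.2 hs.le), div_eq_inv_mul]
      exact mul_le_mul_of_nonneg_left (hS _) (inv_nonneg.2 hs.le)
    have hE : ∫⁻ x, ‖v t x‖ₑ ^ 2 ≤ ENNReal.ofReal (sf t * e₀) := by
      show ∫⁻ x, ‖(sf t)⁻¹ • θ ((sf t)⁻¹ • (x - ρf t • e))‖ₑ ^ 2 ≤ ENNReal.ofReal (sf t * e₀)
      rw [bump_lintegral_sq (inv_nonneg.2 hs.le) (inv_pos.2 hs) _, he₀eq,
        ← ENNReal.ofReal_mul (by positivity), ← ENNReal.ofReal_mul (by positivity)]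
      refine ENNReal.ofReal_le_ofReal (le_of_eq ?_)
      field_simp
    have hmeas : AEStronglyMeasurable (v t) volume := (bump_contDiff _ _ _).continuous.aestronglyMeasurable
    refine (eWeakLpPow_three_le_of_norm_le hmeas hB hE).trans (ENNReal.ofReal_le_ofReal (le_of_eq ?_))
    field_simp
  · -- finite scars: `σ = {0}`; off the origin the satellite has passed
    refine ⟨{0}, fun x hx => ?_⟩
    rw [Finset.mem_singleton] at hx
    set d : ℝ := ‖x‖ with hd_def
    have hd : 0 < d := norm_pos_iff.2 hx
    set r : ℝ := min 1 ((d / (3 + Rθ)) ^ 2) with hr_def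
    have h3R : 0 < 3 + Rθ := by linarith
    have hr0 : 0 < r := lt_min one_pos (by positivity)
    have hr1 : r ≤ 1 := min_le_left _ _
    have hrsq : Real.sqrt r ≤ d / (3 + Rθ) := by
      rw [Real.sqrt_le_left (by positivity)]
      exact min_le_right _ _
    have hr_le_sqrt : r ≤ Real.sqrt r := by
      have h := Real.sqrt_le_sqrt (show r ^ 2 ≤ r by nlinarith)
      rwa [Real.sqrt_sq hr0.le] at h
    refine ⟨r, hr0, 0, fun t ht y hy => ?_⟩
    have ht1 : t < 1 := ht.2
    have ht0' : (0 : ℝ) ≤ 1 - t := by linarith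
    have hs : 0 < sf t := Real.sqrt_pos.2 (by linarith)
    have hs_le_r : sf t ≤ r := by
      show Real.sqrt (1 - t) ≤ r
      rw [Real.sqrt_le_left hr0.le]
      linarith [ht.1]
    have hρ_le : ρf t ≤ Real.sqrt r := Real.sqrt_le_sqrt hs_le_r
    have hρ0 : 0 ≤ ρf t := Real.sqrt_nonneg _
    have hfar : Rθ < ‖(sf t)⁻¹ • (y - ρf t • e)‖ := by
      rw [norm_smul, Real.norm_of_nonneg (inv_nonneg.2 hs.le)]
      have hy' : ‖y - x‖ < r := by rw [← dist_eq_norm]; exact hy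
      have h1 : d - r - ρf t ≤ ‖y - ρf t • e‖ := by
        have hA : ‖x‖ - ‖y - ρf t • e‖ ≤ ‖x - (y - ρf t • e)‖ := norm_sub_norm_le _ _
        have hB : ‖x - (y - ρf t • e)‖ ≤ ‖y - x‖ + ρf t := by
          calc ‖x - (y - ρf t • e)‖ = ‖(x - y) + ρf t • e‖ := by congr 1; abel
            _ ≤ ‖x - y‖ + ‖ρf t • e‖ := norm_add_le _ _
            _ = ‖y - x‖ + ρf t := by
                rw [norm_sub_rev, norm_smul, Real.norm_of_nonneg hρ0, he, mul_one]
        rw [hd_def]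
        linarith
      have h5 : Real.sqrt r * (3 + Rθ) ≤ d := by
        have := mul_le_mul_of_nonneg_right hrsq h3R.le
        rwa [div_mul_cancel₀ _ h3R.ne'] at this
      have h6 : sf t * Rθ < d - r - ρf t := by
        have hsr : sf t ≤ Real.sqrt r := hs_le_r.trans hr_le_sqrt
        have hsqrt_pos : 0 < Real.sqrt r := Real.sqrt_pos.2 hr0
        nlinarith [mul_le_mul_of_nonneg_right hsr hRθ0]
      rw [lt_inv_mul_iff₀ hs]
      linarith
    have hzero : θ ((sf t)⁻¹ • (y - ρf t • e)) = 0 := hθzero _ hfar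
    show ‖(sf t)⁻¹ • θ ((sf t)⁻¹ • (y - ρf t • e))‖ ≤ 0
    rw [hzero, smul_zero, norm_zero]
  · -- NO envelope
    rintro ⟨σ, C', henv⟩
    obtain ⟨D, hD_def⟩ : ∃ D : ℝ, D = ∑ b ∈ σ.erase 0, 4 / ‖b‖ := ⟨_, rfl⟩
    have hD0 : 0 ≤ D := by rw [hD_def]; exact Finset.sum_nonneg fun b _ => by positivity
    obtain ⟨Cabs, hCabs_def⟩ : ∃ Cabs : ℝ, Cabs = |C'| := ⟨_, rfl⟩
    have hCabs : 0 ≤ Cabs := by rw [hCabs_def]; exact abs_nonneg _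
    have hC'le : C' ≤ Cabs := by rw [hCabs_def]; exact le_abs_self _
    have hcard : (0 : ℝ) ≤ σ.card := Nat.cast_nonneg _
    obtain ⟨L, hL_def⟩ : ∃ L : ℝ, L = Cabs * (1 + σ.card * (1 + D) / 2 + 2 * σ.card) + 1 := ⟨_, rfl⟩
    have hL : 0 < L := by
      rw [hL_def]
      have : 0 ≤ Cabs * (1 + σ.card * (1 + D) / 2 + 2 * σ.card) := by positivity
      linarith
    obtain ⟨ρ, hρ_def⟩ : ∃ ρ : ℝ,
        ρ = min (min 1 (1 / (1 + D))) (min (1 / (2 * ‖z₀‖ + 1)) (w₀ / (2 * L))) := ⟨_, rfl⟩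
    have hρpos : 0 < ρ := by rw [hρ_def]; positivity
    have hρ1 : ρ ≤ 1 := by rw [hρ_def]; exact (min_le_left _ _).trans (min_le_left _ _)
    have hρD : ρ ≤ 1 / (1 + D) := by rw [hρ_def]; exact (min_le_left _ _).trans (min_le_right _ _)
    have hρz : ρ ≤ 1 / (2 * ‖z₀‖ + 1) := by
      rw [hρ_def]; exact (min_le_right _ _).trans (min_le_left _ _)
    have hρw : ρ ≤ w₀ / (2 * L) := by rw [hρ_def]; exact (min_le_right _ _).trans (min_le_right _ _)
    have hρD' : ρ * (1 + D) ≤ 1 := by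
      have h := hρD; rw [le_div_iff₀ (by positivity)] at h; linarith
    have hρz' : ρ * (2 * ‖z₀‖ + 1) ≤ 1 := by
      have h := hρz; rw [le_div_iff₀ (by positivity)] at h; linarith
    have hρL : ρ * (2 * L) ≤ w₀ := by
      have h := hρw; rw [le_div_iff₀ (by positivity)] at h; linarith
    obtain ⟨t, ht_def⟩ : ∃ t : ℝ, t = 1 - ρ ^ 4 := ⟨_, rfl⟩
    have hρ4 : ρ ^ 4 ≤ 1 := pow_le_one₀ hρpos.le hρ1
    have ht : t ∈ Ico (0 : ℝ) 1 :=
      ⟨by rw [ht_def]; linarith, by rw [ht_def]; linarith [pow_pos hρpos 4]⟩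
    have hst : sf t = ρ ^ 2 := by
      show Real.sqrt (1 - t) = ρ ^ 2
      rw [ht_def, sub_sub_cancel, show ρ ^ 4 = (ρ ^ 2) ^ 2 by ring, Real.sqrt_sq (sq_nonneg _)]
    have hρt : ρf t = ρ := by
      show Real.sqrt (Real.sqrt (1 - t)) = ρ
      rw [show Real.sqrt (1 - t) = sf t from rfl, hst, Real.sqrt_sq hρpos.le]
    have hs : 0 < sf t := by rw [hst]; positivity
    have hsz : sf t * ‖z₀‖ ≤ ρ / 2 := by
      rw [hst]; nlinarith [norm_nonneg z₀, hρpos]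
    obtain ⟨x, hx_def⟩ : ∃ x : EuclideanSpace ℝ (Fin 3), x = ρ • e + sf t • z₀ := ⟨_, rfl⟩
    have hvx : ‖v t x‖ = w₀ / sf t := by
      show ‖(sf t)⁻¹ • θ ((sf t)⁻¹ • (x - ρf t • e))‖ = w₀ / sf t
      have : (sf t)⁻¹ • (x - ρf t • e) = z₀ := by
        rw [hρt, hx_def, add_sub_cancel_left, smul_smul, inv_mul_cancel₀ hs.ne', one_smul]
      rw [this, norm_smul, Real.norm_of_nonneg (inv_nonneg.2 hs.le), hw₀_def, div_eq_inv_mul]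
    have hbound := henv t ht x
    rw [hvx] at hbound
    have hρe : ‖ρ • e‖ = ρ := by rw [norm_smul, Real.norm_of_nonneg hρpos.le, he, mul_one]
    have hsz' : ‖sf t • z₀‖ ≤ ρ / 2 := by rwa [norm_smul, Real.norm_of_nonneg hs.le]
    have hx_norm_le : ‖x‖ ≤ 2 * ρ := by
      rw [hx_def]
      linarith [norm_add_le (ρ • e) (sf t • z₀)]
    have hx_norm_ge : ρ / 2 ≤ ‖x‖ := by
      rw [hx_def]
      have h1 : ‖ρ • e‖ - ‖sf t • z₀‖ ≤ ‖ρ • e + sf t • z₀‖ := by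
        have := norm_sub_le (ρ • e + sf t • z₀) (sf t • z₀)
        rw [add_sub_cancel_right] at this
        linarith
      linarith
    have hT1 : 0 ≤ Cabs * (1 + D) / 2 := by positivity
    have hT2 : 0 ≤ 2 * Cabs / ρ := by positivity
    have hterm : ∀ b ∈ σ, C' / (‖x - b‖ + Real.sqrt (1 - t)) ≤ Cabs * (1 + D) / 2 + 2 * Cabs / ρ := by
      intro b hb
      change C' / (‖x - b‖ + sf t) ≤ _
      by_cases hb0 : b = 0
      · rw [hb0]
        linarith [envelope_term_scar (s := sf t) hρpos hs hCabs hC'le hx_norm_ge]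
      · have hbD : 4 / ‖b‖ ≤ D := by
          rw [hD_def]
          exact Finset.single_le_sum (f := fun i : EuclideanSpace ℝ (Fin 3) => 4 / ‖i‖)
            (fun i _ => by positivity) (Finset.mem_erase.2 ⟨hb0, hb⟩)
        linarith [envelope_term_far (s := sf t) hρpos hs hCabs hC'le hD0 hx_norm_le hb0 hbD hρD']
    have hsum : ∑ a ∈ σ, C' / (‖x - a‖ + Real.sqrt (1 - t)) ≤
        σ.card * (Cabs * (1 + D) / 2 + 2 * Cabs / ρ) := by
      have h := Finset.sum_le_card_nsmul σ (fun a => C' / (‖x - a‖ + Real.sqrt (1 - t)))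
        (Cabs * (1 + D) / 2 + 2 * Cabs / ρ) (fun a ha => hterm a ha)
      rwa [nsmul_eq_mul] at h
    have hfinal : w₀ / ρ ^ 2 ≤ Cabs + σ.card * (Cabs * (1 + D) / 2 + 2 * Cabs / ρ) := by
      rw [← hst]; linarith [hbound, hsum]
    exact envelope_endgame hL_def hρpos hρ1 hCabs hD0 hcard hρL hfinal

end LorentzOfEnvelope

end Summit.NavierStokesRegularity.NavierStokesRegularity.Theorems
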